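import Literature.NumberTheory.Sieve.SmoothCountSaddleCoreB
import HarnessLib

/-!
# The saddle-point window and analytic core for a small saddle point

Topic `Literature/NumberTheory/Sieve`; a PROVED tool file, companion of `SaddleWindowSecondOrder`,
`SmoothSaddleWindowHT` and `SmoothCountSaddleCoreB` toward `Literature.NumberTheory.Sieve.HTLocalBehaviour`
[HildebrandTenenbaum1986, Thm 3] in the range `y < 8 (log x)³`. For the kernel `A(t) = e^{-t²/2T²}/(α + it)`
the linear Taylor coefficient is `A₁ = -i/α²`; when `α = α(x, y)` is small the window estimate must keep the
odd cross term `(e^{w} - 1) A₁ t` at its true scale `Φ₄ τ t⁴` (`|t| ≤ τ = W/√φ₂`) instead of `Φ₄(t⁴ + t⁶)/2`: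

* `SaddleWindow.norm_window_pointwise_tau` — the pointwise expansion with `c₄ = ‖A₀‖Φ₄ + ‖A₁‖(Φ₃/3 + 2Φ₄τ)`,
  `c₆ = ‖A₀‖Φ₃²/18`;
* `norm_setIntegral_window_saddle_sub_main_le_tau` — Lemma 11 (window part) with these constants;
* `GaussSaddle.abs_rpow_mul_card_sub_main_le_tau` — the analytic core of `SmoothCountSaddleCoreB` with
  this window.

## References

* [HildebrandTenenbaum1986] A. Hildebrand, G. Tenenbaum, Trans. AMS 296 (1986) 265–290, Lemma 11 and
  §4 (4.5)–(4.8), Thm 1 (proof, §5).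
-/

noncomputable section

open Real Complex MeasureTheory Set Filter

namespace Literature.NumberTheory.Sieve

namespace SaddleWindow

/-- **Pointwise second-order expansion of the window integrand, odd cross term kept at scale `τ`.** If
`‖g(t) + φt²/2 - iΦ₃t³/6‖ ≤ Φ₄ t⁴`, `Φ₃|t|³/6 + Φ₄t⁴ ≤ 1`, `‖A(t) - A₀ - A₁t‖ ≤ B₂t²` and `|t| ≤ τ`, then
`‖e^{g(t)} A(t) - e^{-φt²/2}(A₀ + A₀ iΦ₃t³/6 + A₁ t)‖ ≤ e^{-φt²/2}(c₂t² + c₄t⁴ + c₆t⁶ + c₈t⁸)` with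
`c₂ = eB₂`, `c₄ = ‖A₀‖Φ₄ + ‖A₁‖(Φ₃/3 + 2Φ₄τ)`, `c₆ = ‖A₀‖Φ₃²/18`, `c₈ = 2‖A₀‖Φ₄²` (the tree's
`norm_window_pointwise` bounds `Φ₄ t⁴|t| ≤ Φ₄(t⁴ + t⁶)/2`; here `≤ Φ₄ τ t⁴`, which matters when `A₁ = -i/α²`
is large). [cite: HildebrandTenenbaum1986, §4 (4.5)–(4.7)] -/
theorem norm_window_pointwise_tau {g A : ℝ → ℂ} {φ Φ₃ Φ₄ B₂ t τ : ℝ} {A₀ A₁ : ℂ}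
    (hΦ₃ : 0 ≤ Φ₃) (hΦ₄ : 0 ≤ Φ₄) (htτ : |t| ≤ τ)
    (hg : ‖g t + ((φ / 2 * t ^ 2 : ℝ) : ℂ) - ((Φ₃ / 6 * t ^ 3 : ℝ) : ℂ) * I‖ ≤ Φ₄ * t ^ 4)
    (hsmall : Φ₃ / 6 * |t| ^ 3 + Φ₄ * t ^ 4 ≤ 1)
    (hA : ‖A t - A₀ - A₁ * t‖ ≤ B₂ * t ^ 2) :
    ‖Complex.exp (g t) * A t -
        ((Real.exp (-(φ / 2) * t ^ 2) : ℝ) : ℂ) * (A₀ + A₀ * (((Φ₃ / 6 * t ^ 3 : ℝ) : ℂ) * I) + A₁ * t)‖ ≤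
      Real.exp (-(φ / 2) * t ^ 2) *
        (Real.exp 1 * B₂ * t ^ 2 + (‖A₀‖ * Φ₄ + ‖A₁‖ * (Φ₃ / 3 + 2 * Φ₄ * τ)) * t ^ 4 +
          (‖A₀‖ * Φ₃ ^ 2 / 18) * t ^ 6 + 2 * ‖A₀‖ * Φ₄ ^ 2 * t ^ 8) := by
  -- notation
  set G : ℝ := Real.exp (-(φ / 2) * t ^ 2) with hG
  have hG0 : 0 < G := Real.exp_pos _
  set c : ℂ := ((Φ₃ / 6 * t ^ 3 : ℝ) : ℂ) * I with hc
  set w : ℂ := g t + ((φ / 2 * t ^ 2 : ℝ) : ℂ) with hw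
  set R : ℂ := w - c with hR
  set Q : ℂ := A t - A₀ - A₁ * t with hQ
  set W : ℝ := Φ₃ / 6 * |t| ^ 3 + Φ₄ * t ^ 4 with hW
  have hW0 : 0 ≤ W := by positivity
  have hW1 : W ≤ 1 := hsmall
  -- `‖R‖ ≤ Φ₄ t⁴`, `‖c‖ = Φ₃|t|³/6`, `‖w‖ ≤ W ≤ 1`
  have hRn : ‖R‖ ≤ Φ₄ * t ^ 4 := by rw [hR, hw, hc]; exact hg
  have hcn : ‖c‖ = Φ₃ / 6 * |t| ^ 3 := by
    rw [hc, norm_mul, Complex.norm_I, mul_one, Complex.norm_real, Real.norm_eq_abs, abs_mul,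
      abs_of_nonneg (by positivity : (0 : ℝ) ≤ Φ₃ / 6), abs_pow]
  have hwn : ‖w‖ ≤ W := by
    have : w = c + R := by rw [hR]; ring
    rw [this]
    calc ‖c + R‖ ≤ ‖c‖ + ‖R‖ := norm_add_le _ _
      _ ≤ Φ₃ / 6 * |t| ^ 3 + Φ₄ * t ^ 4 := by rw [hcn]; linarith
  have hw1 : ‖w‖ ≤ 1 := hwn.trans hW1
  -- `e^{g} = G e^{w}`
  have hexp : Complex.exp (g t) = (G : ℂ) * Complex.exp w := by
    rw [hG, hw, Complex.ofReal_exp, ← Complex.exp_add]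
    congr 1
    push_cast
    ring
  -- the algebraic decomposition
  have hdecomp : Complex.exp (g t) * A t - (G : ℂ) * (A₀ + A₀ * c + A₁ * t) =
      (G : ℂ) * (Complex.exp w * Q + (Complex.exp w - 1 - w) * A₀ + R * A₀ + (Complex.exp w - 1) * (A₁ * t)) := by
    rw [hexp, hQ, hR]
    ring
  rw [hdecomp, norm_mul, Complex.norm_real, Real.norm_eq_abs, abs_of_pos hG0]
  refine mul_le_mul_of_nonneg_left ?_ hG0.le
  -- the four pieces
  have hexpw : ‖Complex.exp w‖ ≤ Real.exp 1 := by
    rw [Complex.norm_exp]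
    exact Real.exp_le_exp.2 (le_trans (Complex.re_le_norm w) hw1)
  have h1 : ‖Complex.exp w * Q‖ ≤ Real.exp 1 * B₂ * t ^ 2 := by
    rw [norm_mul, mul_assoc]
    exact mul_le_mul hexpw hA (norm_nonneg _) (Real.exp_pos 1).le
  have h2 : ‖(Complex.exp w - 1 - w) * A₀‖ ≤ W ^ 2 * ‖A₀‖ := by
    rw [norm_mul]
    refine mul_le_mul_of_nonneg_right ?_ (norm_nonneg _)
    exact (Complex.norm_exp_sub_one_sub_id_le hw1).trans (pow_le_pow_left₀ (norm_nonneg _) hwn 2)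
  have h3 : ‖R * A₀‖ ≤ Φ₄ * t ^ 4 * ‖A₀‖ := by
    rw [norm_mul]; exact mul_le_mul_of_nonneg_right hRn (norm_nonneg _)
  have h4 : ‖(Complex.exp w - 1) * (A₁ * t)‖ ≤ 2 * W * (‖A₁‖ * |t|) := by
    rw [norm_mul, norm_mul, Complex.norm_real, Real.norm_eq_abs]
    refine mul_le_mul_of_nonneg_right ?_ (by positivity)
    have : Complex.exp w - 1 = (Complex.exp w - 1 - w) + w := by ring
    rw [this]
    calc ‖Complex.exp w - 1 - w + w‖ ≤ ‖Complex.exp w - 1 - w‖ + ‖w‖ := norm_add_le _ _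
      _ ≤ ‖w‖ ^ 2 + ‖w‖ := by linarith [Complex.norm_exp_sub_one_sub_id_le hw1]
      _ ≤ W ^ 2 + W := by nlinarith [norm_nonneg w]
      _ ≤ 2 * W := by nlinarith
  -- elementary inequalities in `t`
  have ht0 : 0 ≤ |t| := abs_nonneg t
  have habs2 : |t| ^ 2 = t ^ 2 := sq_abs t
  have habs3t : |t| ^ 3 * |t| = t ^ 4 := by
    have : |t| ^ 3 * |t| = (|t| ^ 2) ^ 2 := by ring
    rw [this, habs2]; ring
  have habs6 : (|t| ^ 3) ^ 2 = t ^ 6 := by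
    have : (|t| ^ 3) ^ 2 = (|t| ^ 2) ^ 3 := by ring
    rw [this, habs2]; ring
  have h5 : t ^ 4 * |t| ≤ τ * t ^ 4 := by
    rw [mul_comm]; exact mul_le_mul_of_nonneg_right htτ (by positivity)
  have hW2 : W ^ 2 ≤ 2 * ((Φ₃ / 6) ^ 2 * t ^ 6 + Φ₄ ^ 2 * t ^ 8) := by
    rw [hW]
    have hab : ∀ a b : ℝ, (a + b) ^ 2 ≤ 2 * (a ^ 2 + b ^ 2) := fun a b => by nlinarith [sq_nonneg (a - b)]
    calc (Φ₃ / 6 * |t| ^ 3 + Φ₄ * t ^ 4) ^ 2 ≤ 2 * ((Φ₃ / 6 * |t| ^ 3) ^ 2 + (Φ₄ * t ^ 4) ^ 2) := hab _ _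
      _ = 2 * ((Φ₃ / 6) ^ 2 * t ^ 6 + Φ₄ ^ 2 * t ^ 8) := by rw [mul_pow, habs6]; ring
  have hWt : W * |t| ≤ Φ₃ / 6 * t ^ 4 + Φ₄ * (τ * t ^ 4) := by
    rw [hW, add_mul, mul_assoc, habs3t, mul_assoc]
    gcongr
  calc ‖Complex.exp w * Q + (Complex.exp w - 1 - w) * A₀ + R * A₀ + (Complex.exp w - 1) * (A₁ * t)‖
      ≤ ‖Complex.exp w * Q + (Complex.exp w - 1 - w) * A₀ + R * A₀‖ + ‖(Complex.exp w - 1) * (A₁ * t)‖ :=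
        norm_add_le _ _
    _ ≤ ‖Complex.exp w * Q + (Complex.exp w - 1 - w) * A₀‖ + ‖R * A₀‖ + ‖(Complex.exp w - 1) * (A₁ * t)‖ := by
        gcongr; exact norm_add_le _ _
    _ ≤ ‖Complex.exp w * Q‖ + ‖(Complex.exp w - 1 - w) * A₀‖ + ‖R * A₀‖ + ‖(Complex.exp w - 1) * (A₁ * t)‖ := by
        gcongr; exact norm_add_le _ _
    _ ≤ Real.exp 1 * B₂ * t ^ 2 + W ^ 2 * ‖A₀‖ + Φ₄ * t ^ 4 * ‖A₀‖ + 2 * W * (‖A₁‖ * |t|) := by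
        linarith [h1, h2, h3, h4]
    _ = Real.exp 1 * B₂ * t ^ 2 + ‖A₀‖ * W ^ 2 + ‖A₀‖ * Φ₄ * t ^ 4 + 2 * ‖A₁‖ * (W * |t|) := by ring
    _ ≤ Real.exp 1 * B₂ * t ^ 2 + ‖A₀‖ * (2 * ((Φ₃ / 6) ^ 2 * t ^ 6 + Φ₄ ^ 2 * t ^ 8)) + ‖A₀‖ * Φ₄ * t ^ 4 +
          2 * ‖A₁‖ * (Φ₃ / 6 * t ^ 4 + Φ₄ * (τ * t ^ 4)) := by
        gcongr
    _ = Real.exp 1 * B₂ * t ^ 2 + (‖A₀‖ * Φ₄ + ‖A₁‖ * (Φ₃ / 3 + 2 * Φ₄ * τ)) * t ^ 4 +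
          (‖A₀‖ * Φ₃ ^ 2 / 18) * t ^ 6 + 2 * ‖A₀‖ * Φ₄ ^ 2 * t ^ 8 := by ring

/-! ### Integration over the window -/


end SaddleWindow

/-- **Lemma 11, window part, small saddle point.** As `norm_setIntegral_window_saddle_sub_main_le`, with the
constants of `SaddleWindow.norm_window_pointwise_tau`:
`‖∫_{[-τ,τ]} exp(e(t)) A(t) dt - A₀ √(2π/φ)‖ ≤ ‖A₀‖ e^{-φτ²/4} √(4π/φ)`
`+ √(4π/φ) (eB₂ · 4/(eφ) + (‖A₀‖Φ₄ + ‖A₁‖(Φ₃/3 + 2Φ₄τ)) (8/(eφ))² + (‖A₀‖Φ₃²/18)(12/(eφ))³ + 2‖A₀‖Φ₄² (16/(eφ))⁴)`.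
[cite: HildebrandTenenbaum1986, Lemma 11 and §4 (4.5)–(4.8)] -/
theorem norm_setIntegral_window_saddle_sub_main_le_tau {x : ℝ} {y : ℕ} {A : ℝ → ℂ} {A₀ A₁ : ℂ} {B₂ τ : ℝ}
    (hx : 1 < x) (hy : 2 ≤ y) (hτ : 0 ≤ τ) (hB₂ : 0 ≤ B₂) (hA : Continuous A)
    (hAexp : ∀ t ∈ Set.Icc (-τ) τ, ‖A t - A₀ - A₁ * t‖ ≤ B₂ * t ^ 2)
    (hsmall : saddlePhi₃ (saddlePoint x y) y / 6 * τ ^ 3 + saddlePhi₄ (saddlePoint x y) y * τ ^ 4 ≤ 1) :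
    ‖(∫ t in Set.Icc (-τ) τ, Complex.exp (saddleExponent x (saddlePoint x y) y t) * A t) -
        A₀ * ((Real.sqrt (2 * Real.pi / saddlePhi₂ (saddlePoint x y) y) : ℝ) : ℂ)‖ ≤
      ‖A₀‖ * (Real.exp (-(saddlePhi₂ (saddlePoint x y) y / 4) * τ ^ 2) *
          Real.sqrt (4 * Real.pi / saddlePhi₂ (saddlePoint x y) y)) +
        Real.sqrt (4 * Real.pi / saddlePhi₂ (saddlePoint x y) y) *
          (Real.exp 1 * B₂ * (4 * 1 / (Real.exp 1 * saddlePhi₂ (saddlePoint x y) y)) ^ 1 +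
            (‖A₀‖ * saddlePhi₄ (saddlePoint x y) y +
                ‖A₁‖ * (saddlePhi₃ (saddlePoint x y) y / 3 + 2 * saddlePhi₄ (saddlePoint x y) y * τ)) *
              (4 * 2 / (Real.exp 1 * saddlePhi₂ (saddlePoint x y) y)) ^ 2 +
            (‖A₀‖ * saddlePhi₃ (saddlePoint x y) y ^ 2 / 18) *
              (4 * 3 / (Real.exp 1 * saddlePhi₂ (saddlePoint x y) y)) ^ 3 +
            2 * ‖A₀‖ * saddlePhi₄ (saddlePoint x y) y ^ 2 *
              (4 * 4 / (Real.exp 1 * saddlePhi₂ (saddlePoint x y) y)) ^ 4) := by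
  set α : ℝ := saddlePoint x y with hαdef
  have hα0 : 0 < α := saddlePoint_pos hx hy
  set φ : ℝ := saddlePhi₂ α y with hφ
  set Φ₃ : ℝ := saddlePhi₃ α y with hΦ₃
  set Φ₄ : ℝ := saddlePhi₄ α y with hΦ₄
  have hφ0 : 0 < φ := saddlePhi₂_pos hy hα0
  have hΦ₃0 : 0 ≤ Φ₃ := saddlePhi₃_nonneg hα0 y
  have hΦ₄0 : 0 ≤ Φ₄ := saddlePhi₄_nonneg hα0 y
  set F : ℝ → ℂ := fun t => Complex.exp (saddleExponent x α y t) * A t with hF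
  have hFc : Continuous F := continuous_exp_saddleExponent_mul hα0 x y hA
  have hFi : IntegrableOn F (Set.Icc (-τ) τ) := hFc.continuousOn.integrableOn_compact isCompact_Icc
  refine SaddleWindow.norm_setIntegral_window_sub_main_le (Φ₃ := Φ₃) (A₁ := A₁) hφ0 hτ (by positivity)
    (by positivity) (by positivity) (by positivity) hFi fun t ht => ?_
  have htabs : |t| ≤ τ := abs_le.2 ⟨ht.1, ht.2⟩
  have hsmall_t : Φ₃ / 6 * |t| ^ 3 + Φ₄ * t ^ 4 ≤ 1 := by
    have h3 : |t| ^ 3 ≤ τ ^ 3 := pow_le_pow_left₀ (abs_nonneg t) htabs 3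
    have h4 : t ^ 4 ≤ τ ^ 4 := by
      have := pow_le_pow_left₀ (abs_nonneg t) htabs 4
      rwa [(show Even 4 from ⟨2, rfl⟩).pow_abs] at this
    calc Φ₃ / 6 * |t| ^ 3 + Φ₄ * t ^ 4 ≤ Φ₃ / 6 * τ ^ 3 + Φ₄ * τ ^ 4 := by gcongr
      _ ≤ 1 := hsmall
  have hT : ‖saddleExponent x α y t + ((φ / 2 * t ^ 2 : ℝ) : ℂ) - ((Φ₃ / 6 * t ^ 3 : ℝ) : ℂ) * I‖ ≤
      Φ₄ * t ^ 4 := norm_saddleExponent_taylor_four hx hy t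
  exact SaddleWindow.norm_window_pointwise_tau (g := fun u : ℝ => saddleExponent x α y u) hΦ₃0 hΦ₄0 htabs hT
    hsmall_t (hAexp t ht)

namespace GaussSaddle

/-! ### The analytic core, small saddle point -/

set_option maxHeartbeats 1600000 in
/-- **The analytic core of Hildebrand–Tenenbaum's Theorem 1, small saddle point** (Gaussian-smoothed
Perron formula, Gaussian window, three tails and the Gaussian mean of `|ζ|`). Let `x > 1`, `y ≥ 2`,
`α = α(x,y) ≤ 1`, `φ = φ₂(α,y)`, `T_g ≥ 4`, `W > 0`, `τ = W/√φ`, `π/log y ≤ 1`, `T_d ≥ 3`, and suppose: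
the near-axis bound `|ζ(α+it,y)| ≤ ζ(α,y)(1 + a t²)^{-K/2}` on `|t| ≤ π/log y` (`a > 0`, `K ≥ 4`); the decay
`|ζ(α+it,y)| ≤ ε ζ(α,y)` on `π/log y ≤ |t| ≤ T_d`; the window smallness `φ₃τ³/6 + φ₄τ⁴ ≤ 1`. Then
`|x^{-α}Ψ(x,y) − ζ(α,y)/(α√(2πφ))| ≤ (α²/2T_g²)(ζ(α,y)/(α√(2πφ)) + ζ(α,y)(K_w + K_t)/2π) + ζ(α,y)(K_w + K_t)/2π`
`+ (4√(2π)/T_g) · (ζ(α,y)/2π)(√(4π/(aK)) + 2π2^{-K/2}/√a + 2εT_d + e^{-T_d²/T_g²}√(πT_g²))`, where `K_w`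
bounds the window error of `norm_setIntegral_window_saddle_sub_main_le_tau` for `A(t) = e^{-t²/2T_g²}/(α + it)`
and `K_t` the tails of `norm_tailIntegral_le_general` with `ε₁ = ε₂ = ε`, `T = T_d`,
`B₃ = 4T_g² e^{-1} e^{-T_d²/4T_g²}`. [cite: HildebrandTenenbaum1986, Thm 1 (proof, §5) and §4 Lemmas 10–11] -/
theorem abs_rpow_mul_card_sub_main_le_tau {x Tg W Td ε Kw Kt a K : ℝ} {y : ℕ} (hx : 1 < x) (hy : 2 ≤ y)
    (hα1 : saddlePoint x y ≤ 1) (hTg : 4 ≤ Tg) (hW : 0 < W)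
    (hy1 : Real.pi / Real.log y ≤ 1)
    (hTd : 3 ≤ Td) (hε : 0 ≤ ε) (ha : 0 < a) (hK : 4 ≤ K)
    (hnear : ∀ t : ℝ, |t| ≤ Real.pi / Real.log y →
      ‖smoothZetaC ((saddlePoint x y : ℂ) + t * I) y‖ ≤ smoothZeta (saddlePoint x y) y * (1 + a * t ^ 2) ^ (-(K / 2)))
    (hdec : ∀ t : ℝ, Real.pi / Real.log y ≤ |t| → |t| ≤ Td →
      ‖smoothZetaC ((saddlePoint x y : ℂ) + t * I) y‖ ≤ smoothZeta (saddlePoint x y) y * ε)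
    (hsmall : saddlePhi₃ (saddlePoint x y) y / 6 * (W / Real.sqrt (saddlePhi₂ (saddlePoint x y) y)) ^ 3 +
      saddlePhi₄ (saddlePoint x y) y * (W / Real.sqrt (saddlePhi₂ (saddlePoint x y) y)) ^ 4 ≤ 1)
    (hKw : ‖((saddlePoint x y : ℝ) : ℂ)⁻¹‖ *
          (Real.exp (-(saddlePhi₂ (saddlePoint x y) y / 4) * (W / Real.sqrt (saddlePhi₂ (saddlePoint x y) y)) ^ 2) *
            Real.sqrt (4 * Real.pi / saddlePhi₂ (saddlePoint x y) y)) +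
        Real.sqrt (4 * Real.pi / saddlePhi₂ (saddlePoint x y) y) *
          (Real.exp 1 * (1 / saddlePoint x y ^ 3 + 1 / (2 * Tg ^ 2 * saddlePoint x y)) *
              (4 * 1 / (Real.exp 1 * saddlePhi₂ (saddlePoint x y) y)) ^ 1 +
            (‖((saddlePoint x y : ℝ) : ℂ)⁻¹‖ * saddlePhi₄ (saddlePoint x y) y +
                ‖-I / ((saddlePoint x y : ℝ) : ℂ) ^ 2‖ *
                  (saddlePhi₃ (saddlePoint x y) y / 3 + 2 * saddlePhi₄ (saddlePoint x y) y *
                    (W / Real.sqrt (saddlePhi₂ (saddlePoint x y) y)))) *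
              (4 * 2 / (Real.exp 1 * saddlePhi₂ (saddlePoint x y) y)) ^ 2 +
            (‖((saddlePoint x y : ℝ) : ℂ)⁻¹‖ * saddlePhi₃ (saddlePoint x y) y ^ 2 / 18) *
              (4 * 3 / (Real.exp 1 * saddlePhi₂ (saddlePoint x y) y)) ^ 3 +
            2 * ‖((saddlePoint x y : ℝ) : ℂ)⁻¹‖ * saddlePhi₄ (saddlePoint x y) y ^ 2 *
              (4 * 4 / (Real.exp 1 * saddlePhi₂ (saddlePoint x y) y)) ^ 4) ≤ Kw)
    (hKt : (1 + a * (W / Real.sqrt (saddlePhi₂ (saddlePoint x y) y)) ^ 2) ^ (-(K / 4)) *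
          (Real.sqrt (8 * Real.pi / (a * K)) + 2 * (2 : ℝ) ^ (-(K / 4)) * Real.pi / Real.sqrt a) / saddlePoint x y +
        6 * ε * Real.log y + 2 * Real.pi / 3 * ε * Td +
        2 * Real.pi * (4 * Tg ^ 2 * Real.exp (-1) * Real.exp (-(Td ^ 2 / (4 * Tg ^ 2)))) / Td ^ 2 ≤ Kt) :
    |x ^ (-saddlePoint x y) * ((Nat.smoothNumbersUpTo ⌊x⌋₊ (y + 1)).card : ℝ) -
        smoothZeta (saddlePoint x y) y /
          (saddlePoint x y * Real.sqrt (2 * Real.pi * saddlePhi₂ (saddlePoint x y) y))| ≤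
      saddlePoint x y ^ 2 / (2 * Tg ^ 2) *
          (smoothZeta (saddlePoint x y) y /
              (saddlePoint x y * Real.sqrt (2 * Real.pi * saddlePhi₂ (saddlePoint x y) y)) +
            smoothZeta (saddlePoint x y) y / (2 * Real.pi) * (Kw + Kt)) +
        smoothZeta (saddlePoint x y) y / (2 * Real.pi) * (Kw + Kt) +
        4 * Real.sqrt (2 * Real.pi) / Tg * (1 / (2 * Real.pi) * (smoothZeta (saddlePoint x y) y *
          (Real.sqrt (Real.pi / (a * K / 4)) + (2 * (2 : ℝ) ^ (-(K / 2)) / a) * Real.pi / (1 / Real.sqrt a) +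
            ε * (2 * Td) + Real.exp (-(Td ^ 2 / Tg ^ 2)) * Real.sqrt (Real.pi / (1 / Tg ^ 2))))) := by
  set α : ℝ := saddlePoint x y with hαdef
  have hα0 : 0 < α := saddlePoint_pos hx hy
  have hx0 : 0 < x := by linarith
  set φ : ℝ := saddlePhi₂ α y with hφdef
  have hφ0 : 0 < φ := saddlePhi₂_pos hy hα0
  set ζ₀ : ℝ := smoothZeta α y with hζ₀
  have hζ0 : 0 < ζ₀ := smoothZeta_pos hα0
  set L : ℝ := Real.log y with hL
  have hL0 : 0 < L := Real.log_pos (by exact_mod_cast lt_of_lt_of_le one_lt_two hy)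
  have hTg0 : 0 < Tg := by linarith
  have hTd0 : 0 < Td := by linarith
  have hαTg : α ≤ Tg / 2 := by linarith
  set τ : ℝ := W / Real.sqrt φ with hτdef
  have hτ0 : 0 < τ := div_pos hW (Real.sqrt_pos.2 hφ0)
  set A : ℝ → ℂ := kernelA α Tg with hA
  have hAc : Continuous A := continuous_kernelA hα0 Tg
  have hAi : Integrable A := integrable_kernelA hα0 hTg0
  set f : ℝ → ℂ := SaddleKernel.kernelIntegrand x α y A with hf
  have hfi : Integrable f := SaddleKernel.integrable_kernelIntegrand hα0 x y hAc hAi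
  have hK2 : 2 ≤ K := by linarith
  -- (1) the smoothed Perron formula
  have hF3 := GaussPerron.card_smooth_gaussPerron_integral hx.le hα0 hTg0 hαTg y
  have hI := integral_perronDamping_eq hα0 Tg hx0 y
  rw [hI] at hF3
  -- (2) the Gaussian mean of `|ζ|`
  have hJ := integral_norm_le_general (y := y) α hTg0 (L := L) ha hK2 hε hTd0 hζ0.le
    (fun t => norm_smoothZetaC_le hα0 t y) (fun t ht => hnear t ht) (fun t ht1 ht2 => hdec t ht1 ht2)
  -- (3) the window
  have hB₂0 : 0 ≤ 1 / α ^ 3 + 1 / (2 * Tg ^ 2 * α) := by positivity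
  have hwin := norm_setIntegral_window_saddle_sub_main_le_tau (A := A) (A₀ := ((α : ℝ) : ℂ)⁻¹) (A₁ := -I / ((α : ℝ) : ℂ) ^ 2)
    (B₂ := 1 / α ^ 3 + 1 / (2 * Tg ^ 2 * α)) (τ := τ) hx hy hτ0.le hB₂0 hAc
    (fun t _ => norm_kernelA_sub_taylor_le hα0 hTg0 t) hsmall
  -- (4) the tails
  have hB₃0 : 0 ≤ 4 * Tg ^ 2 * Real.exp (-1) * Real.exp (-(Td ^ 2 / (4 * Tg ^ 2))) := by positivity
  have htail := norm_tailIntegral_le_general (x := x) (y := y) (T := Td) (ε₁ := ε) (ε₂ := ε)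
    (B₃ := 4 * Tg ^ 2 * Real.exp (-1) * Real.exp (-(Td ^ 2 / (4 * Tg ^ 2)))) (W := W) (a := a) (K := K)
    hx hy hφ0 hTg0 hW hy1 hTd hε hε ha hK hnear
    (fun t ht1 ht2 => by
      rw [div_le_iff₀ hζ0]; have := hdec t ht1 (ht2.trans hTd); linarith)
    (fun t ht1 ht2 => by
      rw [div_le_iff₀ hζ0]; have := hdec t (hy1.trans ((show (1 : ℝ) ≤ 3 by norm_num).trans ht1)) ht2; linarith)
    hB₃0 (fun t ht => norm_kernelA_le_div_cube α hTg0 hTd0 ht)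
  -- (5) `K = ∫_{window} + ∫_{tails}` and `‖K - α⁻¹ √(2π/φ)‖ ≤ K_w + K_t`
  set KK : ℂ := ∫ t, f t with hKK
  have hsplit : (∫ t in Set.Icc (-τ) τ, f t) + ∫ t in (Set.Icc (-τ) τ)ᶜ, f t = KK :=
    integral_add_compl measurableSet_Icc hfi
  set main : ℂ := ((α : ℝ) : ℂ)⁻¹ * ((Real.sqrt (2 * Real.pi / φ) : ℝ) : ℂ) with hmain
  have hKmain : ‖KK - main‖ ≤ Kw + Kt := by
    have h1 : KK - main = ((∫ t in Set.Icc (-τ) τ, f t) - main) + ∫ t in (Set.Icc (-τ) τ)ᶜ, f t := by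
      rw [← hsplit]; ring
    rw [h1]
    exact (norm_add_le _ _).trans (add_le_add (hwin.trans hKw) (htail.trans hKt))
  -- (6) real parts
  have hmain_re : main.re = α⁻¹ * Real.sqrt (2 * Real.pi / φ) := by
    rw [hmain, ← Complex.ofReal_inv, ← Complex.ofReal_mul, Complex.ofReal_re]
  have hIre : ((((ζ₀ / (2 * Real.pi) : ℝ)) : ℂ) * KK).re = ζ₀ / (2 * Real.pi) * KK.re := Complex.re_ofReal_mul _ _
  set δ : ℝ := ζ₀ / (2 * Real.pi) * (KK - main).re with hδ
  have hKre : ζ₀ / (2 * Real.pi) * KK.re = ζ₀ / (α * Real.sqrt (2 * Real.pi * φ)) + δ := by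
    have : KK.re = main.re + (KK - main).re := by simp
    rw [this, hmain_re, mul_add, hδ]
    congr 1
    rw [show ζ₀ / (2 * Real.pi) * (α⁻¹ * Real.sqrt (2 * Real.pi / φ)) =
      ζ₀ * (1 / (2 * Real.pi) * (α⁻¹ * Real.sqrt (2 * Real.pi / φ))) by ring, sqrt_div_div_eq hφ0 hα0]
    ring
  have hδle : |δ| ≤ ζ₀ / (2 * Real.pi) * (Kw + Kt) := by
    rw [hδ, abs_mul, abs_of_pos (by positivity : 0 < ζ₀ / (2 * Real.pi))]
    exact mul_le_mul_of_nonneg_left ((Complex.abs_re_le_norm _).trans hKmain) (by positivity)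
  -- (7) assemble
  set m : ℝ := ζ₀ / (α * Real.sqrt (2 * Real.pi * φ)) with hm
  have hm0 : 0 ≤ m := by positivity
  set s : ℝ := α ^ 2 / (2 * Tg ^ 2) with hs
  set P : ℝ := x ^ (-α) * ((Nat.smoothNumbersUpTo ⌊x⌋₊ (y + 1)).card : ℝ) with hP
  set Δ : ℝ := ζ₀ / (2 * Real.pi) * (Kw + Kt) with hΔ
  rw [hIre, hKre] at hF3
  have hR := le_trans hF3 (mul_le_mul_of_nonneg_left hJ (by positivity))
  have he1 : Real.exp (-s) ≤ 1 := Real.exp_le_one_iff.2 (neg_nonpos.2 (by positivity))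
  have he2 : 1 - Real.exp (-s) ≤ s := LFunctions.PrimeReciprocal.one_sub_exp_neg_le s
  have hkey : P - m = (P - Real.exp (-s) * (m + δ)) + (Real.exp (-s) - 1) * (m + δ) + δ := by ring
  rw [hkey]
  have hA1 : |P - Real.exp (-s) * (m + δ) + (Real.exp (-s) - 1) * (m + δ) + δ| ≤
      |P - Real.exp (-s) * (m + δ)| + |(Real.exp (-s) - 1) * (m + δ)| + |δ| := by
    refine (abs_add_le _ _).trans ?_
    linarith [abs_add_le (P - Real.exp (-s) * (m + δ)) ((Real.exp (-s) - 1) * (m + δ))]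
  have h2 : |(Real.exp (-s) - 1) * (m + δ)| ≤ s * (m + Δ) := by
    rw [abs_mul, show |Real.exp (-s) - 1| = 1 - Real.exp (-s) by rw [abs_sub_comm]; exact abs_of_nonneg (by linarith)]
    refine mul_le_mul he2 ((abs_add_le _ _).trans ?_) (abs_nonneg _) (by positivity)
    rw [abs_of_nonneg hm0]; linarith
  have h3 : |δ| ≤ Δ := hδle
  linarith [hA1, hR, h2, h3]

end GaussSaddle

end Literature.NumberTheory.Sieve

end
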